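import Mathlib
import Literature.Analysis.FluidPDE.VectorCalculus
import Literature.Analysis.FluidPDE.VorticityCalculus
import Summits.NavierStokesRegularity.NavierStokesRegularity.Theorems.ThreadingFluxErtelTowerVorticityFrozen
import Summits.NavierStokesRegularity.NavierStokesRegularity.Theorems.ThreadingFluxErtelTowerStrainShadowTransport
import Summits.NavierStokesRegularity.NavierStokesRegularity.Theorems.ThreadingFluxErtelTowerStrainShadowCoefficient
import HarnessLib

/-!
# Crux `PoloidalLiouville` (stmt-NavierStokesRegularity-1222, W1), crux idea «radial-jerk-tower» (ns-idea-15 g7):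
# THE STRAIN SHADOW, IV — `λ ≡ 0`, constancy of `k`, and `StrainShadowClassificationLocal` BY NAME

Support file (`--supports stmt-NavierStokesRegularity-1222`, helper).  Experiment cell `ns-wall-extremal`, width hand
ns-wall-eng-5 g6, director KEY-NS #186 («V21 radial-jerk-tower sizes go to eng-5 g6»); critic of record ns-wall-crit-1 g4
(V21 PASS-WITH-PRICE; V21-P2 types `StrainShadowClassificationLocal` as the M rung).  0 kit.

* `eq_smul_self_of_cross_eq_zero`, `curl_radial_smul` (`curl(λx) = ∇λ × x`), `inner_strain_testVector` (Lagrange: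
  `⟪Sx, ‖x‖²Sx − (xᵀSx)x⟫ = ‖Sx × x‖²`), `inner_self_testVector`;
* ★ `shadow_lam_eq_zero` — the radial coefficient VANISHES POINTWISE: `∇λ ∥ x` (curl of a gradient), `∂ₜ∇k = ∇∂ₜk`, so the
  left side of the scalar equation has radial gradient while `∇(λ·xᵀSx) = (…)x + 2λSx`; testing against
  `w = ‖x‖²Sx − (xᵀSx)x ⊥ x` gives `2λ‖Sx × x‖² = 0` (replaces the sketch's «`k = h(‖x‖², t)`, coefficient of `xᵀSx`»
  argument by a pointwise one — no integration of `∇k ∥ x` is needed);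
* `shadow_coeff_const` — zero space gradient and zero time derivative on a preconnected open `I × U` ⇒ constant
  (Mathlib `IsOpen.exists_is_const_of_fderiv_eq_zero`);
* ★★ `strainShadowClassificationLocal : StrainShadowClassificationLocal` — the sketch Prop (Defs twin p692432) BY NAME.

BOOKING (critic's words, V21-P1/P2/P4): a statement about the LINEAR STRAIN SHADOW of the wall — the passive viscous
equation in the prescribed unbounded drift `Sx` — not about `PoloidalLiouville` ⟨1222⟩ or `UnthreadedRigidity` ⟨27585⟩; helper,
no rung credit on W1 (movement 0); it refutes nothing.  `PoloidalLiouville` (1222) / (27585) OPEN; NS regularity NOT proved.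
-/

-- the summit and its single problem share the name (D-0017 nested layout)
set_option linter.dupNamespace false

noncomputable section

namespace Summit.NavierStokesRegularity.NavierStokesRegularity.Theorems.PoloidalLiouville.ErtelTower

open Set Function Filter Topology Metric
open scoped Topology RealInnerProductSpace InnerProductSpace
open Literature.Analysis.FluidPDE
open Summit.NavierStokesRegularity.NavierStokesRegularity.Theorems.PoloidalLiouville.HorizonTower (E3)

/-! ### The strain shadow: the radial coefficient `λ` vanishes -/

section ShadowKill

variable {ν a b c : ℝ} {k lam : ℝ → E3 → ℝ} {I : Set ℝ} {U : Set E3}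

/-- A vector with `g × x = 0`, `x ≠ 0`, is radial. -/
theorem eq_smul_self_of_cross_eq_zero {g x : E3} (h : cross g x = 0) (hx : x ≠ 0) :
    g = (inner ℝ g x / ‖x‖ ^ 2) • x := by
  have hx2 : ‖x‖ ^ 2 ≠ 0 := pow_ne_zero 2 (norm_ne_zero_iff.mpr hx)
  have h0 : g 1 * x 2 - g 2 * x 1 = 0 := by simpa [cross, crossProduct] using congrArg (fun w : E3 => w 0) h
  have h1 : g 2 * x 0 - g 0 * x 2 = 0 := by simpa [cross, crossProduct] using congrArg (fun w : E3 => w 1) h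
  have h2 : g 0 * x 1 - g 1 * x 0 = 0 := by simpa [cross, crossProduct] using congrArg (fun w : E3 => w 2) h
  have hin : inner ℝ g x = g 0 * x 0 + g 1 * x 1 + g 2 * x 2 := by
    simp [EuclideanSpace.inner_eq_star_dotProduct, dotProduct, Fin.sum_univ_three]; ring
  rw [hin, EuclideanSpace.real_norm_sq_eq, Fin.sum_univ_three] at *
  ext i
  fin_cases i <;> simp <;> field_simp
  · linear_combination x 1 * h2 - x 2 * h1
  · linear_combination x 2 * h0 - x 0 * h2
  · linear_combination x 0 * h1 - x 1 * h0

/-- `curl (λ x) = ∇λ × x`. -/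
theorem curl_radial_smul {f : E3 → ℝ} {x : E3} (h : DifferentiableAt ℝ f x) :
    curl (fun y => f y • y) x = cross (gradient f x) x := by
  rw [curl_smul h differentiableAt_fun_id]
  have h1 : curl (fun y : E3 => y) x = 0 := by
    rw [curl_eq_curlCLM]
    have : fderiv ℝ (fun y : E3 => y) x = ContinuousLinearMap.id ℝ E3 := fderiv_id
    rw [this]
    ext i
    fin_cases i <;> simp [curlCLM, curlLM]
  rw [h1, smul_zero, zero_add]
  ext i
  fin_cases i <;> simp [curlCLM, curlLM, cross, crossProduct, gradient_apply_coord, mul_comm]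

/-- Lagrange's identity for the frame: `⟪Sx, ‖x‖²Sx − (xᵀSx)x⟫ = ‖Sx × x‖² = ‖τ‖²`. -/
theorem inner_strain_testVector (x : E3) :
    inner ℝ (strain a b c x) ((‖x‖ ^ 2) • strain a b c x - (quadForm a b c x) • x) = ‖topField a b c x‖ ^ 2 := by
  rw [inner_sub_right, real_inner_smul_right, real_inner_smul_right, real_inner_self_eq_norm_sq, strain_dot_self,
    norm_sq_strain, norm_sq_topField, EuclideanSpace.real_norm_sq_eq, Fin.sum_univ_three]
  simp only [quadForm]
  ring

/-- The test vector `‖x‖²Sx − (xᵀSx)x` is orthogonal to `x`. -/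
theorem inner_self_testVector (x : E3) :
    inner ℝ x ((‖x‖ ^ 2) • strain a b c x - (quadForm a b c x) • x) = 0 := by
  rw [inner_sub_right, real_inner_smul_right, real_inner_smul_right, real_inner_self_eq_norm_sq,
    ← inner_strain_comm, strain_dot_self]
  ring

/-- **THE RADIAL COEFFICIENT VANISHES.**  On the open `I × U` off the principal planes (pairwise distinct strains) let `k`
be jointly smooth with radial space gradient `∇k = λ x`, `λ(t, ·)` smooth on `U`, and suppose the scalar equation
`∂ₜk − ν Dλ[x] − 7νλ = λ·xᵀSx` holds on `I × U`.  Then `λ ≡ 0`: the left side has RADIAL space gradient (`∇λ ∥ x` by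
`curl ∇k = 0`; `∂ₜ∇k = ∇∂ₜk`), while `∇(λ·xᵀSx) = (…)x + 2λ Sx`; testing against `w = ‖x‖²Sx − (xᵀSx)x ⊥ x` gives
`2λ‖Sx × x‖² = 0`. -/
theorem shadow_lam_eq_zero (hbc : b ≠ c) (hI : IsOpen I) (hU : IsOpen U)
    (hoff : U ⊆ {x | x 0 ≠ 0 ∧ x 1 ≠ 0 ∧ x 2 ≠ 0})
    (hk : ContDiffOn ℝ (⊤ : ℕ∞) (Function.uncurry k) (I ×ˢ U))
    (hlamU : ∀ t ∈ I, ContDiffOn ℝ (⊤ : ℕ∞) (lam t) U)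
    (hlam : ∀ t ∈ I, ∀ x ∈ U, gradient (k t) x = lam t x • x)
    (hpde : ∀ t ∈ I, ∀ x ∈ U,
      deriv (fun s => k s x) t - ν * fderiv ℝ (lam t) x x - 7 * ν * lam t x = lam t x * quadForm a b c x) :
    ∀ t ∈ I, ∀ x ∈ U, lam t x = 0 := by
  intro t ht x hx
  have hx' := hoff hx
  have hx0 : x ≠ 0 := by intro h; exact hx'.1 (by rw [h]; rfl)
  have hτ : topField a b c x ≠ 0 := topField_ne_zero hbc hx'
  set K := Function.uncurry k with hKdef
  set w : E3 := (‖x‖ ^ 2) • strain a b c x - (quadForm a b c x) • x with hwdef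
  have hxw : inner ℝ x w = 0 := inner_self_testVector x
  -- smoothness
  have hKat : ContDiffAt ℝ (⊤ : ℕ∞) K (t, x) := contDiffAt_of_contDiffOn_prod hk hI hU ht hx
  have hKd : DifferentiableAt ℝ K (t, x) := hKat.differentiableAt (by simp)
  have hDK : ContDiffAt ℝ (⊤ : ℕ∞) (fderiv ℝ K) (t, x) := hKat.fderiv_right (m := (⊤ : ℕ∞)) (by exact_mod_cast le_top)
  have hDKd : DifferentiableAt ℝ (fderiv ℝ K) (t, x) := hDK.differentiableAt (by simp)
  have hktU : ContDiffOn ℝ (⊤ : ℕ∞) (k t) U := contDiffOn_slice hk ht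
  have hlt : ContDiffOn ℝ (⊤ : ℕ∞) (lam t) U := hlamU t ht
  have hlt2 : ContDiffAt ℝ 2 (lam t) x := (hlt.contDiffAt (hU.mem_nhds hx)).of_le (by norm_cast)
  have hld : DifferentiableAt ℝ (lam t) x := hlt2.differentiableAt (by simp)
  have hDl : DifferentiableAt ℝ (fderiv ℝ (lam t)) x := (hlt2.fderiv_right (m := 1) (by norm_num)).differentiableAt (by simp)
  -- (A) `∇λ` is radial on `U`: `∇λ(z) = μ(z) z`
  have hgradl : ∀ z ∈ U, gradient (lam t) z = (inner ℝ (gradient (lam t) z) z / ‖z‖ ^ 2) • z := by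
    intro z hz
    have hz0 : z ≠ 0 := by intro h; exact (hoff hz).1 (by rw [h]; rfl)
    have hk2 : ContDiffAt ℝ 2 (k t) z := (hktU.contDiffAt (hU.mem_nhds hz)).of_le (by norm_cast)
    have hlz : DifferentiableAt ℝ (lam t) z := ((hlt.contDiffAt (hU.mem_nhds hz)).of_le (by norm_cast) :
      ContDiffAt ℝ 1 (lam t) z).differentiableAt (by simp)
    have h0 : curl (gradient (k t)) z = 0 := curl_gradient_of_contDiffAt hk2
    have hev : gradient (k t) =ᶠ[𝓝 z] fun y => lam t y • y := by
      filter_upwards [hU.mem_nhds hz] with y hy using hlam t ht y hy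
    rw [(curl_congr_nhds hev).eq_of_nhds, curl_radial_smul hlz] at h0
    exact eq_smul_self_of_cross_eq_zero h0 hz0
  have hx2 : ‖x‖ ^ 2 ≠ 0 := pow_ne_zero 2 (norm_ne_zero_iff.mpr hx0)
  have hmud : DifferentiableAt ℝ (fun z : E3 => inner ℝ (gradient (lam t) z) z / ‖z‖ ^ 2) x := by
    have hg1 : ContDiffAt ℝ 1 (gradient (lam t)) x := by
      have h : ContDiffAt ℝ 1 (fderiv ℝ (lam t)) x := hlt2.fderiv_right (m := 1) (by norm_num)
      exact (InnerProductSpace.toDual ℝ E3).symm.contDiff.contDiffAt.comp x h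
    have hi : ContDiffAt ℝ 1 (fun z : E3 => inner ℝ (gradient (lam t) z) z) x := hg1.inner ℝ contDiffAt_id
    have hn : ContDiffAt ℝ 1 (fun z : E3 => ‖z‖ ^ 2) x := contDiffAt_id.norm_sq ℝ
    exact (hi.div hn hx2).differentiableAt (by simp)
  -- (B) `Dλ(x)[w] = 0`
  have hB : fderiv ℝ (lam t) x w = 0 := by
    rw [← Literature.Analysis.FluidPDE.inner_gradient_left, hgradl x hx, real_inner_smul_left, hxw, mul_zero]
  -- (C) `D(z ↦ Dλ(z)[z])(x)[w] = 0`
  have hC : fderiv ℝ (fun z => fderiv ℝ (lam t) z z) x w = 0 := by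
    have h : HasFDerivAt (fun z => fderiv ℝ (lam t) z z)
        ((fderiv ℝ (lam t) x).comp (ContinuousLinearMap.id ℝ E3) + (fderiv ℝ (fderiv ℝ (lam t)) x).flip x) x :=
      hDl.hasFDerivAt.clm_apply (hasFDerivAt_id x)
    rw [h.fderiv]
    simp only [_root_.add_apply, ContinuousLinearMap.comp_apply, ContinuousLinearMap.flip_apply,
      ContinuousLinearMap.id_apply]
    -- `(D²λ x w) x = (D²λ x x) w` by symmetry, `= D(z ↦ Dλ z w)(x)[x] = D(z ↦ μ z ⟪z, w⟫)(x)[x] = 0`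
    have hsymm : fderiv ℝ (fderiv ℝ (lam t)) x w x = fderiv ℝ (fderiv ℝ (lam t)) x x w :=
      (hlt2.isSymmSndFDerivAt (by simp)) w x
    have hDw : fderiv ℝ (fderiv ℝ (lam t)) x x w = fderiv ℝ (fun z => fderiv ℝ (lam t) z w) x x := by
      have h' : HasFDerivAt (fun z => fderiv ℝ (lam t) z w)
          ((fderiv ℝ (lam t) x).comp (0 : E3 →L[ℝ] E3) + (fderiv ℝ (fderiv ℝ (lam t)) x).flip w) x :=
        hDl.hasFDerivAt.clm_apply (hasFDerivAt_const w x)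
      rw [h'.fderiv]
      simp
    have hev : (fun z => fderiv ℝ (lam t) z w) =ᶠ[𝓝 x]
        fun z => (inner ℝ (gradient (lam t) z) z / ‖z‖ ^ 2) * inner ℝ z w := by
      filter_upwards [hU.mem_nhds hx] with z hz
      rw [← Literature.Analysis.FluidPDE.inner_gradient_left]
      conv_lhs => rw [hgradl z hz]
      rw [real_inner_smul_left]
    have hzero : fderiv ℝ (fun z => (inner ℝ (gradient (lam t) z) z / ‖z‖ ^ 2) * inner ℝ z w) x x = 0 := by
      have hi : HasFDerivAt (fun z : E3 => inner ℝ z w) (innerSL ℝ w) x := by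
        have := (innerSL ℝ w).hasFDerivAt (x := x)
        refine this.congr_of_eventuallyEq (Filter.Eventually.of_forall fun z => ?_)
        simp [real_inner_comm]
      rw [fderiv_fun_mul hmud hi.differentiableAt, hi.fderiv]
      simp only [_root_.add_apply, _root_.FunLike.coe_smul, Pi.smul_apply, smul_eq_mul, innerSL_apply_apply]
      rw [real_inner_comm x w, hxw]
      ring
    rw [hsymm, hDw, hev.fderiv_eq, hzero, hB, add_zero]
  -- (D) `D(∂ₜk)(x)[w] = 0`
  have hE : ∀ z ∈ U, deriv (fun s => k s z) t = fderiv ℝ K (t, z) ((1 : ℝ), (0 : E3)) := by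
    intro z hz
    have hd : DifferentiableAt ℝ K (t, z) := (contDiffAt_of_contDiffOn_prod hk hI hU ht hz).differentiableAt (by simp)
    have h1 : HasDerivAt (fun s : ℝ => (s, z)) (1, 0) t := (hasDerivAt_id t).prodMk (hasDerivAt_const t z)
    exact (hd.hasFDerivAt.comp_hasDerivAt t h1).deriv
  have hD : fderiv ℝ (fun z => deriv (fun s => k s z) t) x w = 0 := by
    have hev : (fun z => deriv (fun s => k s z) t) =ᶠ[𝓝 x] fun z => fderiv ℝ K (t, z) ((1 : ℝ), (0 : E3)) := by
      filter_upwards [hU.mem_nhds hx] with z hz using hE z hz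
    rw [hev.fderiv_eq]
    have hinr : HasFDerivAt (fun z : E3 => (t, z)) (ContinuousLinearMap.inr ℝ ℝ E3) x :=
      (hasFDerivAt_const t x).prodMk (hasFDerivAt_id x)
    have hc : HasFDerivAt (fun z : E3 => fderiv ℝ K (t, z)) ((fderiv ℝ (fderiv ℝ K) (t, x)).comp (ContinuousLinearMap.inr ℝ ℝ E3)) x :=
      hDKd.hasFDerivAt.comp x hinr
    have happ := hc.clm_apply (hasFDerivAt_const ((1 : ℝ), (0 : E3)) x)
    rw [happ.fderiv]
    simp only [_root_.add_apply, ContinuousLinearMap.comp_apply, ContinuousLinearMap.flip_apply,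
      ContinuousLinearMap.inr_apply]
    -- symmetry: `D²K[(0,w)][(1,0)] = D²K[(1,0)][(0,w)]`, and `s ↦ DK(s,x)[(0,w)] = λ(s,x)⟪x,w⟫ = 0`
    have hsymm := (hKat.isSymmSndFDerivAt (by
      rw [minSmoothness_of_isRCLikeNormedField]; exact WithTop.coe_le_coe.mpr le_top)) ((0 : ℝ), w) ((1 : ℝ), (0 : E3))
    rw [hsymm]
    have hG0 : ∀ s ∈ I, fderiv ℝ K (s, x) ((0 : ℝ), w) = 0 := by
      intro s hs
      have hd : DifferentiableAt ℝ K (s, x) := (contDiffAt_of_contDiffOn_prod hk hI hU hs hx).differentiableAt (by simp)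
      rw [← inner_gradient_slice_space hd]
      show inner ℝ (gradient (k s) x) w = 0
      rw [hlam s hs x hx, real_inner_smul_left, hxw, mul_zero]
    have hev_s : (fun s => fderiv ℝ K (s, x) ((0 : ℝ), w)) =ᶠ[𝓝 t] fun _ => (0 : ℝ) := by
      filter_upwards [hI.mem_nhds ht] with s hs using hG0 s hs
    have h1 : HasDerivAt (fun s : ℝ => (s, x)) (1, 0) t := (hasDerivAt_id t).prodMk (hasDerivAt_const t x)
    have h2 : HasDerivAt (fun s : ℝ => fderiv ℝ K (s, x)) (fderiv ℝ (fderiv ℝ K) (t, x) ((1 : ℝ), (0 : E3))) t :=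
      hDKd.hasFDerivAt.comp_hasDerivAt t h1
    have h3 : HasDerivAt (fun s : ℝ => fderiv ℝ K (s, x) ((0 : ℝ), w))
        ((fderiv ℝ (fderiv ℝ K) (t, x) ((1 : ℝ), (0 : E3))) ((0 : ℝ), w)) t :=
      ((ContinuousLinearMap.apply ℝ ℝ ((0 : ℝ), w))).hasFDerivAt.comp_hasDerivAt t h2
    have h4 : deriv (fun s : ℝ => fderiv ℝ K (s, x) ((0 : ℝ), w)) t = 0 := by rw [hev_s.deriv_eq, deriv_const]
    rw [h3.deriv] at h4
    simpa using h4
  -- (E) differentiate the scalar equation on the open set `U` in the direction `w`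
  have hev : (fun z => deriv (fun s => k s z) t - ν * fderiv ℝ (lam t) z z - 7 * ν * lam t z)
      =ᶠ[𝓝 x] fun z => lam t z * quadForm a b c z := by
    filter_upwards [hU.mem_nhds hx] with z hz using hpde t ht z hz
  have hdiff : fderiv ℝ (fun z => deriv (fun s => k s z) t - ν * fderiv ℝ (lam t) z z - 7 * ν * lam t z) x w
      = fderiv ℝ (fun z => lam t z * quadForm a b c z) x w := congrArg (fun L : E3 →L[ℝ] ℝ => L w) hev.fderiv_eq
  have hd1 : DifferentiableAt ℝ (fun z => deriv (fun s => k s z) t) x := by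
    have hev' : (fun z => deriv (fun s => k s z) t) =ᶠ[𝓝 x] fun z => fderiv ℝ K (t, z) ((1 : ℝ), (0 : E3)) := by
      filter_upwards [hU.mem_nhds hx] with z hz using hE z hz
    refine DifferentiableAt.congr_of_eventuallyEq ?_ hev'
    have hinr : HasFDerivAt (fun z : E3 => (t, z)) (ContinuousLinearMap.inr ℝ ℝ E3) x :=
      (hasFDerivAt_const t x).prodMk (hasFDerivAt_id x)
    exact ((hDKd.hasFDerivAt.comp x hinr).clm_apply (hasFDerivAt_const ((1 : ℝ), (0 : E3)) x)).differentiableAt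
  have hd2 : DifferentiableAt ℝ (fun z => fderiv ℝ (lam t) z z) x := hDl.clm_apply differentiableAt_fun_id
  have hd2' : DifferentiableAt ℝ (fun z => ν * fderiv ℝ (lam t) z z) x := hd2.const_mul ν
  have hd3 : DifferentiableAt ℝ (fun z => 7 * ν * lam t z) x := hld.const_mul (7 * ν)
  have hq : DifferentiableAt ℝ (quadForm a b c) x := (contDiff_quadForm a b c (n := 1)).differentiable (by simp) x
  have hd12 : DifferentiableAt ℝ (fun z => deriv (fun s => k s z) t - ν * fderiv ℝ (lam t) z z) x := hd1.sub hd2'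
  rw [fderiv_fun_sub hd12 hd3, fderiv_fun_sub hd1 hd2', fderiv_const_mul hd2, fderiv_const_mul hld,
    fderiv_fun_mul hld hq] at hdiff
  simp only [_root_.sub_apply, _root_.FunLike.coe_smul, Pi.smul_apply, _root_.add_apply,
    smul_eq_mul, hB, hC, hD, mul_zero, sub_zero, fderiv_quadForm_apply] at hdiff
  -- `hdiff : 0 = lam t x * (2 * ⟪Sx, w⟫) + quadForm x * 0`, i.e. `2 λ ‖τ‖² = 0`
  rw [hwdef, inner_strain_testVector] at hdiff
  have hτ2 : ‖topField a b c x‖ ^ 2 ≠ 0 := pow_ne_zero 2 (norm_ne_zero_iff.mpr hτ)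
  have : lam t x * (2 * ‖topField a b c x‖ ^ 2) = 0 := by linarith
  rcases mul_eq_zero.mp this with h | h
  · exact h
  · exact absurd h (mul_ne_zero two_ne_zero hτ2)

end ShadowKill

/-! ### The strain shadow: constancy of the coefficient and the LOCAL CLASSIFICATION by name -/

section ShadowClassification

variable {k : ℝ → E3 → ℝ} {I : Set ℝ} {U : Set E3}

/-- A jointly smooth scalar with vanishing space gradient and vanishing time derivative on a preconnected open `I × U`
is constant there. -/
theorem shadow_coeff_const (hI : IsOpen I) (hIc : IsPreconnected I) (hU : IsOpen U) (hUc : IsPreconnected U)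
    (hk : ContDiffOn ℝ (⊤ : ℕ∞) (Function.uncurry k) (I ×ˢ U))
    (hgrad : ∀ t ∈ I, ∀ x ∈ U, gradient (k t) x = 0)
    (hdt : ∀ t ∈ I, ∀ x ∈ U, deriv (fun s => k s x) t = 0) :
    ∃ C : ℝ, ∀ t ∈ I, ∀ x ∈ U, k t x = C := by
  have hopen : IsOpen (I ×ˢ U) := hI.prod hU
  have hconn : IsPreconnected (I ×ˢ U) := hIc.prod hUc
  have hdiff : DifferentiableOn ℝ (Function.uncurry k) (I ×ˢ U) := hk.differentiableOn (by simp)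
  have hzero : (I ×ˢ U).EqOn (fderiv ℝ (Function.uncurry k)) 0 := by
    rintro ⟨t, x⟩ ⟨ht, hx⟩
    have hd : DifferentiableAt ℝ (Function.uncurry k) (t, x) :=
      (contDiffAt_of_contDiffOn_prod hk hI hU ht hx).differentiableAt (by simp)
    have h10 : fderiv ℝ (Function.uncurry k) (t, x) ((1 : ℝ), (0 : E3)) = 0 := by
      have h1 : HasDerivAt (fun s : ℝ => (s, x)) (1, 0) t := (hasDerivAt_id t).prodMk (hasDerivAt_const t x)
      rw [← (hd.hasFDerivAt.comp_hasDerivAt t h1).deriv]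
      exact hdt t ht x hx
    have h0v : ∀ v : E3, fderiv ℝ (Function.uncurry k) (t, x) ((0 : ℝ), v) = 0 := by
      intro v
      rw [← inner_gradient_slice_space hd v]
      show inner ℝ (gradient (k t) x) v = 0
      rw [hgrad t ht x hx, inner_zero_left]
    apply ContinuousLinearMap.ext
    rintro ⟨r, v⟩
    have hsplit : ((r, v) : ℝ × E3) = r • ((1 : ℝ), (0 : E3)) + ((0 : ℝ), v) := by simp
    rw [hsplit, map_add, map_smul, h10, h0v]
    simp
  obtain ⟨C, hC⟩ := hopen.exists_is_const_of_fderiv_eq_zero hconn hdiff hzero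
  exact ⟨C, fun t ht x hx => hC (t, x) ⟨ht, hx⟩⟩

/-- ★★ **`StrainShadowClassificationLocal` (ErtelTowerSketch v1.1 Part B, V21-P2 «M rung») is a theorem.**
LOCAL STRAIN-SHADOW CLASSIFICATION OFF THE PRINCIPAL PLANES: every smooth divergence-free sphere-tangent solution of the
passive viscous equation `∂ₜB + DB[Sx] − SB = νΔB` in a trace-free triaxial strain, on a preconnected open `I × U` avoiding
the principal planes, is `C·exp(xᵀSx/2ν)·(Sx × x)` for one constant `C`.  Proof chain (the sketch's, kernel-checked):
`⟪B,x⟫ ≡ 0 ⇒ ⟪B,Sx⟫ ≡ 0 ⇒ ⟪B,S²x⟫ = ν div(SB)` (`shadow_inner_strain_eq_zero`, `shadow_inner_strain_sq_eq`, the two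
transport identities); `B = k·B⋆` (`shadow_exists_coeff`); `∇k = λx` (`shadow_gradient_coeff_radial`); the scalar equation
`∂ₜk − νDλ[x] − 7νλ = λ·xᵀSx` (`shadow_coeff_pde`, from the survivor's own equation `StrainShadowSurvivor`); `λ ≡ 0`
(`shadow_lam_eq_zero`); `k` constant (`shadow_coeff_const`).  No analyticity, no gluing. -/
theorem strainShadowClassificationLocal : StrainShadowClassificationLocal := by
  intro ν a b c B I U hν hab hbc hca htr hI hIc hU hUc hoff hB hdiv heq htan
  have hS : ∀ t ∈ I, ∀ x ∈ U, inner ℝ (B t x) (strain a b c x) = 0 :=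
    shadow_inner_strain_eq_zero hI hU hB hdiv heq htan
  have hsq := shadow_inner_strain_sq_eq hI hU hB hdiv heq htan
  obtain ⟨k, hk, hBk⟩ := shadow_exists_coeff (ν := ν) hbc hoff hB htan hS
  have hrad := shadow_gradient_coeff_radial hν hab hbc hca htr hU hoff hk hBk hdiv hsq
  have hx0 : ∀ x ∈ U, x ≠ 0 := fun x hx h => (hoff hx).1 (by rw [h]; rfl)
  set lam : ℝ → E3 → ℝ := fun t x => inner ℝ (gradient (k t) x) x / ‖x‖ ^ 2 with hlamdef
  have hlam : ∀ t ∈ I, ∀ x ∈ U, gradient (k t) x = lam t x • x := hrad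
  have hlamU : ∀ t ∈ I, ContDiffOn ℝ (⊤ : ℕ∞) (lam t) U := by
    intro t ht
    have hg : ContDiffOn ℝ (⊤ : ℕ∞) (gradient (k t)) U :=
      (InnerProductSpace.toDual ℝ E3).symm.contDiff.comp_contDiffOn
        ((contDiffOn_slice hk ht).fderiv_of_isOpen hU (by simp))
    refine (hg.inner ℝ contDiffOn_id).div (contDiffOn_id.norm_sq ℝ) fun x hx => ?_
    exact pow_ne_zero 2 (norm_ne_zero_iff.mpr (hx0 x hx))
  have hlamd : ∀ t ∈ I, ∀ x ∈ U, DifferentiableAt ℝ (lam t) x := fun t ht x hx =>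
    ((hlamU t ht).differentiableOn (by simp)).differentiableAt (hU.mem_nhds hx)
  have hpde := shadow_coeff_pde hν hbc htr hI hU hoff hk hBk heq hlam hlamd
  have hlam0 := shadow_lam_eq_zero hbc hI hU hoff hk hlamU hlam hpde
  have hgrad0 : ∀ t ∈ I, ∀ x ∈ U, gradient (k t) x = 0 := fun t ht x hx => by
    rw [hlam t ht x hx, hlam0 t ht x hx, zero_smul]
  have hdt0 : ∀ t ∈ I, ∀ x ∈ U, deriv (fun s => k s x) t = 0 := by
    intro t ht x hx
    have h := hpde t ht x hx
    have hl0 : fderiv ℝ (lam t) x = 0 := by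
      have hev : lam t =ᶠ[𝓝 x] fun _ => (0 : ℝ) := by
        filter_upwards [hU.mem_nhds hx] with z hz using hlam0 t ht z hz
      rw [hev.fderiv_eq]; simp
    rw [hl0, hlam0 t ht x hx] at h
    simpa using h
  obtain ⟨C, hC⟩ := shadow_coeff_const hI hIc hU hUc hk hgrad0 hdt0
  refine ⟨C, fun t ht x hx => ?_⟩
  rw [hBk t ht x hx, hC t ht x hx, smul_smul]

end ShadowClassification

end Summit.NavierStokesRegularity.NavierStokesRegularity.Theorems.PoloidalLiouville.ErtelTower
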